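import Summits.QuantumFields.BalabanUV.T4Continuum.Spine.NE5.SmallnessPrintedKind
import Summits.QuantumFields.BalabanUV.T4Continuum.Spine.NE1p.DressedOutputAnalytic

/-!
# Spine/NE5/EnvelopeFromActivities — row NE5 (node U3), route P1: the W2 wall (leaves L04op ∕ L04hist ∕ L04 =
# `StepModel.OutputEnvelope` ⇒ fibre envelopes ⇒ `DataLipschitz`, located gap G-ne5p1-1′) MOVED FROM THE E-LAYER TO THE H-LAYER:
# the output envelope of a step model whose output IS the localized cluster sum (2.13) of its activities follows, in kernel, from
# per-polymer holomorphy of the activities in the step's INPUT DATA and a data-free (2.38)-majorant on a neighbourhood of each base box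

Cell `pub-balaban-gaps` (YM blitz Y1, track G2), seat `ne5` (`prover-pub-balaban-gaps-ne5-g2-0`), triage sheet `HOME/ne/NE5.md` §4 (M2) ∕ §9
(n1).  Imports `Spine/NE5/SmallnessPrintedKind` (gen 0 of this seat: leaf index + ε₁-faces) and `Spine/NE1p/DressedOutputAnalytic` (row NE1′
crew: B13 p. 15's analyticity sentence as a kernel implication over an ARBITRARY complex normed parameter space); modifies nothing;
THEOREMS ONLY.  Companion file `Spine/NE5/EnvelopeOnRecord` puts §1 on Bałaban's torus catalogue `tsys 4 N` and on the row's
carriers of record `B13Carriers.TwoRuns.carriers` with every geometry binder discharged.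

WHY.  The NE5 route's W2 binder is the E-LAYER statement `StepModel.OutputEnvelope W κ G` (`T4InputCauchyRateData` :582): around every
admissible base point, on the two-margin box of operator ∕ history data, the step output at a scale-k domain is complex differentiable in the
data and bounded by `G·e^{−κ d(X)}`.  The census of record books it «NOT inhabited by the O1 instance of record; the END consumes it as a
hypothesis» (D4-CRUX-SOCKETS §7, Q-D4-ne5-1) and prices the NE5-specific share of the shared step object at «(2.41) re-read along input
lines, [II] pp. 15–21».  But the E-layer passage is ALREADY kernel: row D4's design point M2 («E := locE H by (2.13); holomorphy of E follows
from that of H», `B13LocEAnalytic`, seam `Beta/RemainderSeamHolo`) and row NE1′'s `DressedOutputAnalytic.analytic_and_bounded_locE_param`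
(activities complex differentiable in a Banach parameter on an open set + a parameter-free (2.38)-majorant + B13's footprint-locality ∕
(1.26) ∕ volume ∕ (2.27) binders + the one-run rate∕smallness clauses ⟹ `locE` complex differentiable there AND bounded by the (2.41)
envelope `e ν c₁ K₀² A e^{−r₁ d(X)}` — [KP86] zero-freeness via `B13Resummation.kp_condition`, `norm_locE_le_of_small`).  This file
applies that theorem with the parameter space `Op × Hist` of the NE5 step model:
* §1 `outputEnvelope_of_activities` — for a step model whose output is, scale by scale and domain by domain, (2.13) of a polymer gas whose
  activities are functions of the data (`hrep`, the shared object's design rule «E := locE H»), the H-LAYER DATA «around every base box an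
  open neighbourhood on which every activity is complex differentiable in the data and dominated by `A e^{−R d(Z)}`» (`hH`) + the
  scale-uniform geometry binders ⟹ `OutputEnvelope W κ (e ν c₁ K₀² A)`.
* §2 the three W2 leaves of `LeafIndex` BY NAME: `l04op_of_activities`, `l04hist_of_activities`, `l04_of_activities` (`Λ = e ν c₁ K₀² A/(1−ρ₀)`).
* §3 `ne5_of_leaves_fibre_activities` — END face E1′ with L04op ∧ L04hist REPLACED by the H-layer data; every other leaf displayed;
  `ne5_of_leaves_activities` — END face E1 (consumed currencies L04 ∕ L09) likewise.
* §4 the printed-kind reading of the constant: with the (2.38) majorant constant written `A = C₃·ε₁` ([II] Lemma 3: «|H(Z)| ≤ C₃ε₁ exp(…)»,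
  TYPE only) BOTH one-run smallness clauses of the W2 road — the [KP86] convergence clause `C₃ε₁·e^{b+1}K₀νc₁ ≤ 1` ((2.39)–(2.40)-type) and
  the route's sharp rate clause L11 `ω + Λ·c_H < θ′` with `Λ = e ν c₁ K₀² C₃ε₁/(1−ρ₀)` — are ε₁-THRESHOLDS: `ne5_of_leaves_fibre_activities_eps`,
  `eps_threshold_activities` (ONE `ε⋆ > 0` for both, letters only).  This complements gen 0's `SmallnessPrintedKind` (which put ε₁ on the
  W3 gain): on the W2 side the modulus `Λ` is ∝ the (2.38) constant BY THE KERNEL FORM OF (2.41), not by a reading.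

WHAT THIS LOCALISES (the honest residue, by name).  After this file the W2 wall of NE5 on a shared step object built to the design rule
«E := locE H» is EXACTLY the H-layer datum `hH`: the (2.14)-activities, as functions of the step's operator and history data, complex
differentiable on a neighbourhood of the admissible two-margin box with a DATA-UNIFORM (2.38)-majorant there — i.e. [II] Lemma 3 re-read
for margin-perturbed operators ((2.16)–(2.17) p. 16) and budget-perturbed potentials ((2.18) p. 16): the SAME layer and the same kind of
datum row D4's builder list asks for (D4-CRUX-SOCKETS §9 (K3): `hH` + `Lemma3OnH`, there in the background-configuration direction), and
(T3)-territory in the cell's books.  No E-layer ∕ cluster-sum ∕ zero-freeness obligation is left on the NE5 side either.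

HONEST FRAMING.  NE5 (`T4OutputRate.NE5`) is a cell NEW ESTIMATE — NOT PRINTED (GAPS G-t4-U3-1) and NOT PROVED; this file is [folklore]
bookkeeping over an ABSTRACT `StepModel` and abstract polymer systems (by-name composition of tree theorems); it instantiates NO leaf on
Bałaban's objects (0/12 unchanged), asserts nothing printed (0 cite tags; «…» are TYPE∕CONTEXT loci), and decides no printed O(1).  Rung
(B)+1 bookkeeping on a FIXED finite T⁴ — NOT the continuum limit by itself, NOT infinite volume, NOT a mass gap, NOT Clay.  Spine PROVED
0/9.  HONEST DEPENDENCY: continuum YM on T⁴ ⇐ BetaPertH ∧ nine spine estimates (0/9 proved); BetaPertH ⇐ (D1) ∧ (D4) ∧ CAP+tail.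
0 sorry; axioms standard.
-/

noncomputable section

open Set Metric

namespace Summit.QuantumFields.BalabanUV.T4Continuum.Spine.NE5

open Literature.MathematicalPhysics.QuantumFieldTheory.Balaban1983to89
open Literature.MathematicalPhysics.QuantumFieldTheory.Balaban1983to89.T4OutputRate
open Literature.MathematicalPhysics.QuantumFieldTheory.Balaban1983to89.T4InputCauchyRateData
open Literature.MathematicalPhysics.QuantumFieldTheory.Balaban1983to89.B13FamilySum (Ineq126 VolBound Ineq227)
open Literature.MathematicalPhysics.QuantumFieldTheory.Balaban1983to89.B13Resummation (locE)
open Summit.QuantumFields.BalabanUV.T4Continuum.NE1p.DressedOutputAnalytic (analytic_and_bounded_locE_param)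

/-! ## §1 The output envelope from H-layer data -/

section HLayer

variable {C : Carriers} {Op Hist : Type*} [NormedAddCommGroup Op] [NormedSpace ℂ Op] [NormedAddCommGroup Hist]
  [NormedSpace ℂ Hist] (M : StepModel C Op Hist)
variable {PDom PCube : ℕ → Type*} [∀ k, Fintype (PDom k)] [∀ k, DecidableEq (PDom k)] [∀ k, DecidableEq (PCube k)]
  (ι : (k : ℕ) → PDom k → PDom k → Prop) [∀ k, DecidableRel (ι k)] [∀ k, Std.Refl (ι k)] [∀ k, Std.Symm (ι k)]
variable {cubes reach : (k : ℕ) → PDom k → Finset (PCube k)} {dP : (k : ℕ) → PDom k → ℝ}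
  {fp : (k : ℕ) → C.Dom → Finset (PCube k)} {act : (k : ℕ) → Op × Hist → PDom k → ℂ}
  {W : Set (ℕ → ℝ)} {A R κ κ₀ K₀ c₁ c b ν : ℝ}

variable
  -- (2.13) AS THE DEFINITION of the step output, scale by scale and domain by domain (design rule «E := locE H»)
  (hrep : ∀ (k : ℕ) (X : C.Dom) (z : Op × Hist), C.scale X = k →
    M.Out k z.1 z.2 X = locE (ι k) (cubes k) (act k z) (fp k X))
  -- B13's footprint-locality ∕ reach ∕ (1.26) ∕ volume binders, uniformly in the scale; (2.27) and non-emptiness per domain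
  (hloc : ∀ (k : ℕ) (Z Z' : PDom k), ι k Z' Z → ∃ q ∈ reach k Z, q ∈ cubes k Z')
  (hreach : ∀ (k : ℕ) (Z : PDom k), ((reach k Z).card : ℝ) ≤ ν * (cubes k Z).card)
  (hd : ∀ (k : ℕ) (Z : PDom k), 0 ≤ dP k Z) (hA : 0 ≤ A) (hK₀ : 0 ≤ K₀) (hc₁ : 0 ≤ c₁) (hν : 0 ≤ ν) (hκ₀ : 0 ≤ κ₀)
  (hκ : 0 ≤ κ) (hc : 0 ≤ c) (hb : κ * c ≤ b)
  (h126 : ∀ k, Ineq126 (Finset.univ : Finset (PDom k)) (cubes k) (dP k) κ₀ K₀)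
  (hvol : ∀ k, VolBound (Finset.univ : Finset (PDom k)) (cubes k) (dP k) c₁)
  (h227 : ∀ (k : ℕ) (X : C.Dom), C.scale X = k →
    Ineq227 (Finset.univ : Finset (PDom k)) (cubes k) (dP k) (fp k X) (C.d X) c)
  (hne : ∀ (k : ℕ) (X : C.Dom), C.scale X = k → (fp k X).Nonempty)
  -- the one-run rate and [KP86]-smallness clauses of (2.39)–(2.41)
  (hrate : κ + 2 * κ₀ + 2 ≤ R) (hsmall : A * Real.exp (b + 1) * K₀ * ν * c₁ ≤ 1)
  -- THE H-LAYER DATUM: around every base box an open neighbourhood on which every activity is complex differentiable in the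
  -- data and dominated by the data-free (2.38)-majorant `A e^{−R d(Z)}`
  (hH : ∀ k, ∀ g ∈ W, ∀ (U : C.BgB) (p : Op × Hist), p ∈ M.Base k g U →
    ∃ V : Set (Op × Hist), IsOpen V ∧ M.box k p ⊆ V ∧
      (∀ Z : PDom k, DifferentiableOn ℂ (fun z : Op × Hist => act k z Z) V) ∧
      (∀ z ∈ V, ∀ Z : PDom k, ‖act k z Z‖ ≤ A * Real.exp (-(R * dP k Z))))

include hrep hloc hreach hd hA hK₀ hc₁ hν hκ₀ hκ hc hb h126 hvol h227 hne hrate hsmall hH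

/-- **THE OUTPUT ENVELOPE FROM H-LAYER DATA.**  If the step model's output at every scale-`k` domain is the localized cluster sum
(2.13) of a scale-`k` polymer gas whose activities are functions of the step's data (`hrep`), the polymer systems obey B13's
footprint-locality ∕ reach ∕ (1.26) ∕ volume binders uniformly in `k` and (2.27) at every domain, the one-run clauses
`κ + 2κ₀ + 2 ≤ R` and `A e^{b+1} K₀ ν c₁ ≤ 1` hold, and around every admissible base box there is an open neighbourhood on which every
activity is complex differentiable in the data and dominated by `A e^{−R d(Z)}` (`hH`), then `OutputEnvelope W κ (e ν c₁ K₀² A)`: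
on the box the output is complex differentiable in the data (restriction from the neighbourhood) and bounded by the (2.41) envelope.
Proof = `NE1p.DressedOutputAnalytic.analytic_and_bounded_locE_param` at the parameter space `Op × Hist`, BY NAME. [folklore] -/
theorem outputEnvelope_of_activities : M.OutputEnvelope W κ (Real.exp 1 * ν * c₁ * K₀ ^ 2 * A) := by
  intro k g hg U p hp X hX
  obtain ⟨V, hV, hbox, hhol, hmaj⟩ := hH k g hg U p hp
  obtain ⟨hdiff, hbd⟩ :=
    analytic_and_bounded_locE_param (ι k) (m := fun Z => A * Real.exp (-(R * dP k Z))) (act := act k) hV (hloc k)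
      (hreach k) (hd k) hA hK₀ hc₁ hν hκ₀ hκ hc hb (h126 k) (hvol k) (h227 k X hX) hrate hsmall (hne k X hX)
      (fun Z _ => hhol Z) (fun z hz Z _ => hmaj z hz Z) (fun Z _ => le_rfl)
  refine ⟨(hdiff.mono hbox).congr fun z _ => hrep k X z hX, fun z hz => ?_⟩
  rw [hrep k X z hX]
  exact hbd z (hbox hz)

/-! ## §2 The three W2 leaves of `LeafIndex` BY NAME -/

/-- **L04op (operator fibre envelope) FROM H-LAYER DATA** — `StepModel.opFibreEnvelope_of_outputEnvelope` ∘ §1. [folklore] -/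
theorem l04op_of_activities : L04op M W κ (Real.exp 1 * ν * c₁ * K₀ ^ 2 * A) :=
  M.opFibreEnvelope_of_outputEnvelope
    (outputEnvelope_of_activities M ι hrep hloc hreach hd hA hK₀ hc₁ hν hκ₀ hκ hc hb h126 hvol h227 hne hrate hsmall hH)

/-- **L04hist (history fibre envelope) FROM H-LAYER DATA** — `StepModel.histFibreEnvelope_of_outputEnvelope` ∘ §1. [folklore] -/
theorem l04hist_of_activities : L04hist M W κ (Real.exp 1 * ν * c₁ * K₀ ^ 2 * A) :=
  M.histFibreEnvelope_of_outputEnvelope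
    (outputEnvelope_of_activities M ι hrep hloc hreach hd hA hK₀ hc₁ hν hκ₀ hκ hc hb h126 hvol h227 hne hrate hsmall hH)

/-- **L04 (the consumed two-point bound `DataLipschitz`, modulus `Λ = e ν c₁ K₀² A/(1 − ρ₀)` in margin units) FROM H-LAYER DATA** at
any relative reach `ρ₀ < 1` — `StepModel.dataLipschitz_of_outputEnvelope` ∘ §1 (Cauchy on the unit disc along the two coordinate
legs). [folklore] -/
theorem l04_of_activities {ρ₀ : ℝ} (hρ₀ : ρ₀ < 1) :
    L04 M W κ (Real.exp 1 * ν * c₁ * K₀ ^ 2 * A / (1 - ρ₀)) ρ₀ :=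
  M.dataLipschitz_of_outputEnvelope
    (outputEnvelope_of_activities M ι hrep hloc hreach hd hA hK₀ hc₁ hν hκ₀ hκ hc hb h126 hvol h227 hne hrate hsmall hH) hρ₀

/-! ## §3 END face E1′ with the W2 wall replaced by the H-layer data -/

/-- **E1′ WITH W2 := H-LAYER DATA.**  `LeafIndex.ne5_of_leaves_fibre` BY NAME with its binders `l04op ∧ l04hist` manufactured by §2
(`G = e ν c₁ K₀² A`); every other leaf — L01–L03 (identification), L05∕L06 (levels), L07 (row NE2's rate), L08 (insertion rate),
L09aff ∧ L09blind ∧ L09hom ∧ L09unit (W3 at gain `cH`), L10 (`l10near`, `l10first`), L11 (`l11`) — displayed unchanged. [folklore] -/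
theorem ne5_of_leaves_fibre_activities {EA : Functional C C.BgA} {EB : Functional C C.BgB}
    {EA₀ E₀ E₁ δ δ' θ θ' cH ω ρ₀ B : ℝ} {k₀ : ℕ} (l01 : L01 M EA W) (l02 : L02 M EB W) (l03 : L03 M EB W)
    (l05 : L05 EA W EA₀ κ) (l06 : L06 EB W E₀ κ) (l07 : L07 M W δ θ) (l08 : L08 M W κ E₀ δ' θ) (l09aff : L09aff M W)
    (l09blind : L09blind M W) (l09hom : L09hom M W) (l09unit : L09unit M W κ E₁ cH ω) (hE₁ : 0 < E₁) (hδ : 0 ≤ δ + δ')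
    (hθ : 0 ≤ θ) (hθθ' : θ ≤ θ') (hθ'1 : θ' ≤ 1) (hcH : 0 ≤ cH) (hω : 0 < ω) (hρ₀ : ρ₀ < 1)
    (l10near : (δ + δ') * θ ^ k₀ + cH * (EA₀ + E₀) / (1 - ω) ≤ ρ₀) (hB : 0 ≤ B)
    (l10first : ∀ k < k₀, EA₀ + E₀ ≤ B * θ ^ k)
    (l11 : ω + Real.exp 1 * ν * c₁ * K₀ ^ 2 * A / (1 - ρ₀) * cH < θ') :
    NE5 EA EB W κ θ'
      ((Real.exp 1 * ν * c₁ * K₀ ^ 2 * A / (1 - ρ₀) * (δ + δ') + B) * (θ' - ω) /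
        (θ' - (ω + Real.exp 1 * ν * c₁ * K₀ ^ 2 * A / (1 - ρ₀) * cH))) :=
  ne5_of_leaves_fibre M l01 l02 l03
    (l04op_of_activities M ι hrep hloc hreach hd hA hK₀ hc₁ hν hκ₀ hκ hc hb h126 hvol h227 hne hrate hsmall hH)
    (l04hist_of_activities M ι hrep hloc hreach hd hA hK₀ hc₁ hν hκ₀ hκ hc hb h126 hvol h227 hne hrate hsmall hH)
    l05 l06 l07 l08 l09aff l09blind l09hom l09unit hE₁ (by positivity) hδ hθ hθθ' hθ'1 hcH hω hρ₀ l10near hB l10first l11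

/-- **E1 WITH W2 := H-LAYER DATA** (consumed currencies: L04 `DataLipschitz` at modulus `Λ = e ν c₁ K₀² A/(1−ρ₀)`, L09 `InsertionDampedNat`
at gain `cH`).  `LeafIndex.ne5_of_leaves` BY NAME with `l04` manufactured by `l04_of_activities`; every other leaf displayed. [folklore] -/
theorem ne5_of_leaves_activities {EA : Functional C C.BgA} {EB : Functional C C.BgB}
    {EA₀ E₀ δ δ' θ θ' cH ω ρ₀ B : ℝ} {k₀ : ℕ} (l01 : L01 M EA W) (l02 : L02 M EB W) (l03 : L03 M EB W)
    (l05 : L05 EA W EA₀ κ) (l06 : L06 EB W E₀ κ) (l07 : L07 M W δ θ) (l08 : L08 M W κ E₀ δ' θ) (l09 : L09 M W κ cH ω)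
    (hδ : 0 ≤ δ + δ') (hθ : 0 ≤ θ) (hθθ' : θ ≤ θ') (hθ'1 : θ' ≤ 1) (hcH : 0 ≤ cH) (hω : 0 < ω) (hρ₀ : ρ₀ < 1)
    (l10near : (δ + δ') * θ ^ k₀ + cH * (EA₀ + E₀) / (1 - ω) ≤ ρ₀) (hB : 0 ≤ B)
    (l10first : ∀ k < k₀, EA₀ + E₀ ≤ B * θ ^ k)
    (l11 : ω + Real.exp 1 * ν * c₁ * K₀ ^ 2 * A / (1 - ρ₀) * cH < θ') :
    NE5 EA EB W κ θ'
      ((Real.exp 1 * ν * c₁ * K₀ ^ 2 * A / (1 - ρ₀) * (δ + δ') + B) * (θ' - ω) /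
        (θ' - (ω + Real.exp 1 * ν * c₁ * K₀ ^ 2 * A / (1 - ρ₀) * cH))) :=
  ne5_of_leaves M l01 l02 l03
    (l04_of_activities M ι hrep hloc hreach hd hA hK₀ hc₁ hν hκ₀ hκ hc hb h126 hvol h227 hne hrate hsmall hH hρ₀)
    l05 l06 l07 l08 l09 (div_nonneg (by positivity) (sub_pos.2 hρ₀).le) hδ hθ hθθ' hθ'1 hcH hω l10near hB l10first l11

end HLayer

/-! ## §4 The printed-kind reading of the constant: `A = C₃·ε₁` makes BOTH smallness clauses of the W2 road ε₁-thresholds -/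

section Eps

/-- **ONE THRESHOLD FOR BOTH ε₁-CLAUSES OF THE W2 ROAD** (letters only): for nonnegative letters and a target rate `θ′ > ω` at analytic
reach `ρ₀ < 1` there is `ε⋆ > 0` such that every `ε₁ < ε⋆` satisfies the [KP86] convergence clause `C₃ε₁·e^{b+1}K₀νc₁ ≤ 1` of (2.39)–(2.41)
AND the route's sharp rate clause in the form `(e ν c₁ K₀² C₃)·cH·ε₁ < (θ′ − ω)(1 − ρ₀)` — explicitly
`ε⋆ = min(1/(C₃e^{b+1}K₀νc₁ + 1), (θ′−ω)(1−ρ₀)/(e ν c₁ K₀² C₃ cH + 1))`, by `SmallnessPrintedKind.mul_lt_of_lt_threshold`. [folklore] -/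
theorem eps_threshold_activities {C3 K₀ ν c₁ b cH θ' ω ρ₀ : ℝ} (hC3 : 0 ≤ C3) (hK₀ : 0 ≤ K₀) (hν : 0 ≤ ν) (hc₁ : 0 ≤ c₁)
    (hcH : 0 ≤ cH) (hωθ' : ω < θ') (hρ₀ : ρ₀ < 1) :
    ∃ εs : ℝ, 0 < εs ∧ ∀ ε₁, ε₁ < εs →
      C3 * ε₁ * Real.exp (b + 1) * K₀ * ν * c₁ ≤ 1 ∧
        Real.exp 1 * ν * c₁ * K₀ ^ 2 * C3 * cH * ε₁ < (θ' - ω) * (1 - ρ₀) := by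
  set a₁ : ℝ := C3 * Real.exp (b + 1) * K₀ * ν * c₁ with ha₁_def
  set a₂ : ℝ := Real.exp 1 * ν * c₁ * K₀ ^ 2 * C3 * cH with ha₂_def
  have ha₁ : 0 ≤ a₁ := by positivity
  have ha₂ : 0 ≤ a₂ := by positivity
  have hT : 0 < (θ' - ω) * (1 - ρ₀) := mul_pos (sub_pos.2 hωθ') (sub_pos.2 hρ₀)
  refine ⟨min (1 / (a₁ + 1)) ((θ' - ω) * (1 - ρ₀) / (a₂ + 1)),
    lt_min (div_pos one_pos (by linarith)) (div_pos hT (by linarith)), fun ε₁ hε₁ => ⟨?_, ?_⟩⟩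
  · have h1 : a₁ * ε₁ < 1 := mul_lt_of_lt_threshold ha₁ one_pos (hε₁.trans_le (min_le_left _ _))
    have h2 : C3 * ε₁ * Real.exp (b + 1) * K₀ * ν * c₁ = a₁ * ε₁ := by rw [ha₁_def]; ring
    rw [h2]; exact h1.le
  · exact mul_lt_of_lt_threshold ha₂ hT (hε₁.trans_le (min_le_right _ _))

variable {C : Carriers} {Op Hist : Type*} [NormedAddCommGroup Op] [NormedSpace ℂ Op] [NormedAddCommGroup Hist]
  [NormedSpace ℂ Hist] (M : StepModel C Op Hist)
variable {PDom PCube : ℕ → Type*} [∀ k, Fintype (PDom k)] [∀ k, DecidableEq (PDom k)] [∀ k, DecidableEq (PCube k)]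
  (ι : (k : ℕ) → PDom k → PDom k → Prop) [∀ k, DecidableRel (ι k)] [∀ k, Std.Refl (ι k)] [∀ k, Std.Symm (ι k)]

/-- **E1′ WITH W2 := H-LAYER DATA AT MAJORANT CONSTANT `C₃·ε₁`, BOTH W2 CLAUSES AS ε₁-CONDITIONS.**  §3 with `A := C₃·ε₁`: the [KP86]
clause is supplied as `C₃ε₁·e^{b+1}K₀νc₁ ≤ 1` and L11 as `(e ν c₁ K₀² C₃)·cH·ε₁ < (θ′ − ω)(1 − ρ₀)` (turned into the face's `l11` by
`SmallnessPrintedKind.smallness_of_eps`); L10 still displayed.  With `eps_threshold_activities` both hold for every `0 ≤ ε₁ < ε⋆`. [folklore] -/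
theorem ne5_of_leaves_fibre_activities_eps
    {cubes reach : (k : ℕ) → PDom k → Finset (PCube k)} {dP : (k : ℕ) → PDom k → ℝ}
    {fp : (k : ℕ) → C.Dom → Finset (PCube k)} {act : (k : ℕ) → Op × Hist → PDom k → ℂ}
    {W : Set (ℕ → ℝ)} {C3 ε₁ R κ κ₀ K₀ c₁ c b ν : ℝ}
    (hrep : ∀ (k : ℕ) (X : C.Dom) (z : Op × Hist), C.scale X = k →
      M.Out k z.1 z.2 X = locE (ι k) (cubes k) (act k z) (fp k X))
    (hloc : ∀ (k : ℕ) (Z Z' : PDom k), ι k Z' Z → ∃ q ∈ reach k Z, q ∈ cubes k Z')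
    (hreach : ∀ (k : ℕ) (Z : PDom k), ((reach k Z).card : ℝ) ≤ ν * (cubes k Z).card)
    (hd : ∀ (k : ℕ) (Z : PDom k), 0 ≤ dP k Z) (hC3 : 0 ≤ C3) (hε₁ : 0 ≤ ε₁) (hK₀ : 0 ≤ K₀) (hc₁ : 0 ≤ c₁) (hν : 0 ≤ ν)
    (hκ₀ : 0 ≤ κ₀) (hκ : 0 ≤ κ) (hc : 0 ≤ c) (hb : κ * c ≤ b)
    (h126 : ∀ k, Ineq126 (Finset.univ : Finset (PDom k)) (cubes k) (dP k) κ₀ K₀)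
    (hvol : ∀ k, VolBound (Finset.univ : Finset (PDom k)) (cubes k) (dP k) c₁)
    (h227 : ∀ (k : ℕ) (X : C.Dom), C.scale X = k →
      Ineq227 (Finset.univ : Finset (PDom k)) (cubes k) (dP k) (fp k X) (C.d X) c)
    (hne : ∀ (k : ℕ) (X : C.Dom), C.scale X = k → (fp k X).Nonempty) (hrate : κ + 2 * κ₀ + 2 ≤ R)
    (hKP : C3 * ε₁ * Real.exp (b + 1) * K₀ * ν * c₁ ≤ 1)
    (hH : ∀ k, ∀ g ∈ W, ∀ (U : C.BgB) (p : Op × Hist), p ∈ M.Base k g U →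
      ∃ V : Set (Op × Hist), IsOpen V ∧ M.box k p ⊆ V ∧
        (∀ Z : PDom k, DifferentiableOn ℂ (fun z : Op × Hist => act k z Z) V) ∧
        (∀ z ∈ V, ∀ Z : PDom k, ‖act k z Z‖ ≤ C3 * ε₁ * Real.exp (-(R * dP k Z))))
    {EA : Functional C C.BgA} {EB : Functional C C.BgB} {EA₀ E₀ E₁ δ δ' θ θ' cH ω ρ₀ B : ℝ} {k₀ : ℕ}
    (l01 : L01 M EA W) (l02 : L02 M EB W) (l03 : L03 M EB W) (l05 : L05 EA W EA₀ κ) (l06 : L06 EB W E₀ κ)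
    (l07 : L07 M W δ θ) (l08 : L08 M W κ E₀ δ' θ) (l09aff : L09aff M W) (l09blind : L09blind M W) (l09hom : L09hom M W)
    (l09unit : L09unit M W κ E₁ cH ω) (hE₁ : 0 < E₁) (hδ : 0 ≤ δ + δ') (hθ : 0 ≤ θ) (hθθ' : θ ≤ θ') (hθ'1 : θ' ≤ 1)
    (hcH : 0 ≤ cH) (hω : 0 < ω) (hρ₀ : ρ₀ < 1) (l10near : (δ + δ') * θ ^ k₀ + cH * (EA₀ + E₀) / (1 - ω) ≤ ρ₀) (hB : 0 ≤ B)
    (l10first : ∀ k < k₀, EA₀ + E₀ ≤ B * θ ^ k)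
    (hS : Real.exp 1 * ν * c₁ * K₀ ^ 2 * C3 * cH * ε₁ < (θ' - ω) * (1 - ρ₀)) :
    NE5 EA EB W κ θ'
      ((Real.exp 1 * ν * c₁ * K₀ ^ 2 * (C3 * ε₁) / (1 - ρ₀) * (δ + δ') + B) * (θ' - ω) /
        (θ' - (ω + Real.exp 1 * ν * c₁ * K₀ ^ 2 * (C3 * ε₁) / (1 - ρ₀) * cH))) := by
  have l11 : ω + Real.exp 1 * ν * c₁ * K₀ ^ 2 * (C3 * ε₁) / (1 - ρ₀) * cH < θ' := by
    have h := smallness_of_eps (G := Real.exp 1 * ν * c₁ * K₀ ^ 2 * C3) (cI := cH) (ε₁ := ε₁) hρ₀ hS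
    have heq : Real.exp 1 * ν * c₁ * K₀ ^ 2 * C3 / (1 - ρ₀) * (cH * ε₁) =
        Real.exp 1 * ν * c₁ * K₀ ^ 2 * (C3 * ε₁) / (1 - ρ₀) * cH := by ring
    rwa [heq] at h
  exact ne5_of_leaves_fibre_activities M ι hrep hloc hreach hd (mul_nonneg hC3 hε₁) hK₀ hc₁ hν hκ₀ hκ hc hb h126 hvol h227
    hne hrate hKP hH l01 l02 l03 l05 l06 l07 l08 l09aff l09blind l09hom l09unit hE₁ hδ hθ hθθ' hθ'1 hcH hω hρ₀ l10near hB
    l10first l11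

end Eps

end Summit.QuantumFields.BalabanUV.T4Continuum.Spine.NE5
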